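import Literature.Geometry.Lorentzian.NearKerrLeaf
import Literature.Geometry.Lorentzian.FinalEraPackage2
import Summits.FinalStateConjecture.FinalStateConjecture.Statement
import Summits.FinalStateConjecture.FinalStateConjecture.Theses.DissipativeFinalMotions
import Summits.FinalStateConjecture.FinalStateConjecture.Theorems.DissipativeFinalMotionsDispersalFromBudget
import HarnessLib

/-!
# Conditional closure of stub `stub_clusterDisperses` (v2-S5) of line `dilated-leaves-virial-certificate`
# of crux `Capture` (stmt-FinalStateConjecture-10115) from item `RadiativeLyapunovBudget` (stmt-10993)

The line `dilated-leaves-virial-certificate` of the crux `Capture` (routes `BartnikGapSettling` /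
`QuietWindowCapture`, summit `FinalStateConjecture`; skeleton
`Summits/FinalStateConjecture/FinalStateConjecture/Cruxes/Capture/Lines/dilated_leaves_virial_certificate.lean`,
v2) turns registered dilated epochs of a rev-2 final-era package `p : FinalEraPackage₂ 𝒟` into
DISPERSAL.  Its pair sector (`p.N ≤ 2`) is landed kinematics (`stub_pairRecurs`, `stub_twoBodyEscape`,
`stub_pairDisperses`); its CLUSTER SECTOR `3 ≤ p.N` (`stub_clusterDisperses`) is open (a system energy
ledger plus "no zero-energy recurrent all-pairs-dilated cluster": Chazy's `h ≥ 0` table made dissipative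
for `N = 3`, Newtonian-open for `N ≥ 4`).  This file records, kernel-checked, the ONE existing named item
that carries the cluster sector outright:

* `disperses_of_radiativeLyapunovBudget` — item `RadiativeLyapunovBudget` of route `DissipativeFinalMotions`
  (stmt-FinalStateConjecture-10993, OPEN: every rev-2 package of an admissible MGHD with complete `𝓘⁺`
  carries an antitone, bounded-below budget on `[T, ∞)` which drops by `ε(D') > 0` within lag `L(D')`
  whenever two labels loiter `D'`-close for a unit of time), fed to the PROVED item `DispersalFromBudget`
  (stmt-FinalStateConjecture-10156, `Theorems.DispersalFromBudget_proof`) and the package's Lipschitz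
  clause (W3), gives `‖p.ξ i t − p.ξ j t‖ → ∞` for all `i ≠ j` — for EVERY `N`, with no leaves, no
  registration and no two-body escape;
* `stub_clusterDisperses_of_radiativeLyapunovBudget` — hence the registered signature of
  `stub_clusterDisperses`, VERBATIM, under that single named hypothesis (registered helper sub-goal of the
  crux item; the precise sense of "S5 is blocked on stmt-10993").

Caveat recorded for the planners: 10993 is STRONGER than what the line's own lever needs (it contains the
uniform loitering-radiates floor the card set out to avoid; the line needs only ledger ACCURACY, which
however reaches `N ≤ 2` only).  The kinematic clauses (P), (W1)–(W4) of the package plus recurrence carry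
NO dispersal content by themselves for `N = 3` (explicit `C^∞` counter-kinematics in the lead's folder,
`work/stubs/cluster_kinematics.md`: the absolute-velocity `κ`-bracket of (W4) licenses the whole Newtonian
term once speeds exceed `1/√(2κ)`).  No definitions; no new named facts (the hypothesis is the existing
route item, imported from its `Theses` file as CONVENTIONS §2 permits for `Theorems` files).

References: Marchal–Saari, J. Differential Equations 20 (1976), Thm 1 and §5; C. Marchal, *The Three-Body
Problem* (1990), §11.7.9, Table VI; Dafermos–Luk arXiv:1710.01722, p. 8.
-/

-- the doubled `FinalStateConjecture.FinalStateConjecture` path component trips dupNamespace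
set_option linter.dupNamespace false

noncomputable section

namespace Summit.FinalStateConjecture.FinalStateConjecture.Theorems.BartnikGapSettling.Capture

open Set Filter Function Topology
open scoped Manifold ContDiff ENNReal BigOperators
open Literature.Geometry.Lorentzian

/-- **Every rev-2 final-era package disperses, given the radiative Lyapunov budget** (item
`RadiativeLyapunovBudget`, stmt-FinalStateConjecture-10993, fed to the PROVED item `DispersalFromBudget`,
stmt-FinalStateConjecture-10156, `Theorems.DispersalFromBudget_proof`): for admissible data, an MGHD with
complete `𝓘⁺` and any `p : FinalEraPackage₂ 𝒟`, `‖p.ξ i t - p.ξ j t‖ → ∞` for all `i ≠ j`.  The package is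
unbundled by `FinalEraPackage₂.isFinalEra₂` (its clause (O) is the body of `exteriorOf`, definitionally),
the budget's Lipschitz input is clause (W3) `p.norm_sub_le`. [folklore] -/
theorem disperses_of_radiativeLyapunovBudget
    (hB : Summit.FinalStateConjecture.FinalStateConjecture.Theses.DissipativeFinalMotions.RadiativeLyapunovBudget) :
    ∀ (X : Type) [TopologicalSpace X] [ChartedSpace E3 X] [IsManifold (𝓡 3) ∞ X] [T2Space X]
      [SecondCountableTopology X] [ConnectedSpace X],
      ∀ D ∈ admissibleVacuumData X, ∀ 𝒟 : VacuumCauchyDevelopment D, 𝒟.IsMaximal →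
        Summit.FinalStateConjecture.HasCompleteNullInfinity 𝒟.toCauchyDevelopment →
          ∀ p : FinalEraPackage₂ 𝒟.toCauchyDevelopment,
            ∀ i j, i ≠ j → Tendsto (fun t ↦ ‖p.ξ i t - p.ξ j t‖) atTop atTop := by
  intro X _ _ _ _ _ _ D hD 𝒟 hmax hCNI p i j hij
  obtain ⟨E, hanti, hbdd, hcoer⟩ := hB X D hD 𝒟 hmax hCNI p.N p.M p.a p.T p.δ p.V p.C₁ p.C₂ p.ρ₀ p.κ
    p.ξ p.β p.U₀ p.B₀ p.B p.Ψ₀ p.Ψ p.O p.isFinalEra₂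
  exact Summit.FinalStateConjecture.FinalStateConjecture.Theorems.DispersalFromBudget_proof p.N p.T p.V
    p.ξ E p.norm_sub_le hanti hbdd hcoer i j hij

/-- **Stub S5 (v2) is carried by item `RadiativeLyapunovBudget`** (stmt-FinalStateConjecture-10993): the
registered signature of `stub_clusterDisperses`, VERBATIM, under that single named hypothesis — the
leaves, `3 ≤ p.N` and the registered dilated epochs are not used (`disperses_of_radiativeLyapunovBudget`).
[folklore] -/
theorem stub_clusterDisperses_of_radiativeLyapunovBudget :
    Summit.FinalStateConjecture.FinalStateConjecture.Theses.DissipativeFinalMotions.RadiativeLyapunovBudget →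
    ∀ (X : Type) [TopologicalSpace X] [ChartedSpace E3 X] [IsManifold (𝓡 3) ∞ X] [T2Space X]
      [SecondCountableTopology X] [ConnectedSpace X],
      ∀ D ∈ admissibleVacuumData X, ∀ 𝒟 : VacuumCauchyDevelopment D, 𝒟.IsMaximal →
        Summit.FinalStateConjecture.HasCompleteNullInfinity 𝒟.toCauchyDevelopment →
          ∀ (N₀ : ℕ) (m₀ χ : ℝ) (k₁ : ℕ) (ε₁ : ℝ≥0∞), 0 < m₀ → χ < 1 → 0 < ε₁ →
            (∀ (k : ℕ) (ε : ℝ≥0∞), 0 < ε → ∀ K : Set 𝒟.carrier, IsCompact K →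
              ∃ (N : ℕ) (M a : Fin N → ℝ) (S : Set 𝒟.carrier), N ≤ N₀ ∧
                (∀ i, m₀ ≤ M i ∧ M i ≤ m₀⁻¹) ∧
                  Disjoint S (𝒟.metric.causalPast 𝒟.timeOrientation K) ∧
                    𝒟.toCauchyDevelopment.IsNearKerrLeaf k ε N M a S ∧
                      (k₁ ≤ k → ε ≤ ε₁ → ∀ i, |a i| ≤ χ * M i)) →
            ∀ p : FinalEraPackage₂ 𝒟.toCauchyDevelopment, 3 ≤ p.N →
              (∃ θ C₀ : ℝ, θ * p.V < 1 ∧ ∀ D₁ t₀ : ℝ, ∃ tᵣ : Fin p.N → ℝ, (∀ i, t₀ ≤ tᵣ i) ∧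
                ∀ i j, i ≠ j → |tᵣ i - tᵣ j| ≤ θ * ‖p.ξ i (tᵣ i) - p.ξ j (tᵣ j)‖ + C₀ ∧
                  D₁ ≤ ‖p.ξ i (tᵣ i) - p.ξ j (tᵣ j)‖) →
                ∀ i j, i ≠ j → Tendsto (fun t ↦ ‖p.ξ i t - p.ξ j t‖) atTop atTop := by
  intro hB X _ _ _ _ _ _ D hD 𝒟 hmax hCNI N₀ m₀ χ k₁ ε₁ _ _ _ _ p _ _ i j hij
  exact disperses_of_radiativeLyapunovBudget hB X D hD 𝒟 hmax hCNI p i j hij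

end Summit.FinalStateConjecture.FinalStateConjecture.Theorems.BartnikGapSettling.Capture

end
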